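import Summits.ValiantsHypothesis.ValiantsHypothesis.Theorems.KPlusLogSqLawTropicalBMarkedEdgeCoreKOneJ

/-!
# Route «KPlusLogSqLaw», crux `TropicalB` (stmt-ValiantsHypothesis-19771) — MARKED-EDGE sector, NESTED-TRIANGLE CORE, ALL sizes:
# THEOREM K1-J, chain form — the Regime-I configuration «p on the joined b4-chain of σZ⁻¹σB behind q» is not realisable

HONEST FRAMING.  Helper file (cell `pub-symmetroid`, seat val-sym-trop-p4 (g21), 2026-08-29; `--supports stmt-ValiantsHypothesis-19771 --as
helper`).  A repackaging of `core_K1J` (p697066) with the hypotheses in the form in which the located REGIME THEOREM delivers them (memo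
HOME/val-sym-trop-p4/g21/RIGIDITY-g21.md §3–§4): two-colour reachability of `b1` from `b0` (first half of a Q-cover of the pair (B,C)),
three-colour reachability of `b0` from `σZ⁻¹ b3`, and the PURE `σZ⁻¹σB`-chain `b2 → … → b1 → σZ⁻¹ b1 → … → b0` off the gates (i.e. `σZ⁻¹σB` joined
with `b1` behind `b2` on its `b4`-chain).  Nothing here proves the nested-triangle law; nothing concerns `TropicalB` in its window, `WeakLifting`,
the doors, `MatrixDescartes` (stmt-ValiantsHypothesis-18050) or VP ≠ VNP.
-/

set_option linter.dupNamespace false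
set_option autoImplicit false

namespace Summit.ValiantsHypothesis.ValiantsHypothesis.Theorems.KPlusLogSqLaw
namespace MarkedEdge
namespace Core

open Finset

variable {V : Type*} [Fintype V] [DecidableEq V]

omit [Fintype V] [DecidableEq V] in
/-- A pure chain `c, x c, …, xᵏ c = t` (`k ≥ 1`) whose nodes before the end avoid `s, t` is a down-walk to `t` for any arc predicate
containing the arcs of `x`. [folklore] -/
theorem transGen_of_chain (x : Equiv.Perm V) (A : V → V → Prop) (hA : ∀ i, A i (x i)) (s t c : V) (hst : s ≠ t) (k : ℕ)
    (hk : 1 ≤ k)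
    (hend : (x ^ k) c = t) (hW : ∀ i, i < k → (x ^ i) c ≠ t ∧ (x ^ i) c ≠ s) :
    Relation.TransGen (fun i j => i ≠ s ∧ i ≠ t ∧ j ≠ s ∧ i ≠ j ∧ A i j) c t := by
  -- TransGen from c to x^j c for 1 ≤ j ≤ k
  have main : ∀ j, 1 ≤ j → j ≤ k → Relation.TransGen (fun i j => i ≠ s ∧ i ≠ t ∧ j ≠ s ∧ i ≠ j ∧ A i j) c ((x ^ j) c) := by
    intro j
    induction j with
    | zero => intro h; omega
    | succ j ih =>
      intro _ hjk
      have hWj := hW j (by omega)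
      -- the arc x^j c → x^(j+1) c
      have hstep : (fun i j => i ≠ s ∧ i ≠ t ∧ j ≠ s ∧ i ≠ j ∧ A i j) ((x ^ j) c) ((x ^ (j + 1)) c) := by
        refine ⟨hWj.2, hWj.1, ?_, ?_, by rw [pow_succ_apply]; exact hA _⟩
        · -- x^(j+1) c ≠ s: either j+1 < k (then off the gates) or j+1 = k (then it is t ≠ s … but t = s is not excluded a priori);
          -- we use: if j+1 < k then hW, else hend and hW 0 … ; handle both
          by_cases hj1 : j + 1 < k
          · exact (hW (j + 1) hj1).2
          · have : j + 1 = k := by omega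
            rw [this, hend]; exact hst.symm
        · intro hEq
          rw [pow_succ_apply] at hEq
          -- x fixes x^j c: then the chain is constant from j on, so x^k c = x^j c ≠ t, contradiction
          have hfix : ∀ i, (x ^ (j + i)) c = (x ^ j) c := by
            intro i
            induction i with
            | zero => rfl
            | succ i ih2 => rw [← add_assoc, pow_succ_apply, ih2]; exact hEq.symm
          have := hfix (k - j)
          rw [show j + (k - j) = k by omega, hend] at this
          exact hWj.1 this.symm
      rcases Nat.eq_zero_or_pos j with hj0 | hjpos
      · subst hj0
        rw [zero_add, pow_one]
        have h1 := hstep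
        rw [pow_zero, Equiv.Perm.one_apply, zero_add, pow_one] at h1
        exact Relation.TransGen.single h1
      · exact (ih hjpos (by omega)).tail hstep
  have := main k hk le_rfl
  rwa [hend] at this

omit [Fintype V] [DecidableEq V] in
/-- Monotonicity of the transitive closure in the relation (pointwise implication). [folklore] -/
theorem transGen_weaken (r p : V → V → Prop) (hle : r ≤ p) {a c : V} (h : Relation.TransGen r a c) : Relation.TransGen p a c := by
  induction h with
  | single h1 => exact Relation.TransGen.single (hle _ _ h1)
  | tail _ h1 ih => exact ih.tail (hle _ _ h1)

section Core

variable (ok : V → V → Prop) (w g : V → V → ℤ) (b : Fin 5 → V)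

/-- **THEOREM K1-J, chain form.**  In a realisation of the nested-triangle core it is impossible that: `σZ⁻¹ b3` reaches `b0` by a rising walk with
relative arcs of `σB, σC, σE`; `b1` is reachable from `b0` by a rising walk with relative arcs of `σB, σC` (e.g. the first half of a Q₁₈-cover);
and the relative cover `x = σZ⁻¹σB` carries the pure chain `b2 → x b2 → … → b1 → σZ⁻¹ b1 → … → b0` off the gates (`b1 = xᵏ b2`,
`b0 = xᵏ' (σZ⁻¹ b1)`).  [this seat's theorem; corollary of `core_K1J`] -/
theorem core_K1J_chain (hb : Function.Injective b)
    (hoff : ∀ i j, j ≠ i → g i j = 0) (hmark : ∀ l, g (b l) (b l) = (2 : ℤ) ^ (l : ℕ)) (haux : ∀ i, (∀ l, b l ≠ i) → g i i = 0)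
    {θB θC θE θZ : ℤ} {σB σC σE σZ : Equiv.Perm V} (hBC : θB < θC) (hCE : θC < θE) (hEZ : θE < θZ)
    (hB : (∀ i, ok i (σB i)) ∧ ∀ τ : Equiv.Perm V, τ ≠ σB → (∀ i, ok i (τ i)) →
      ∑ i, (w i (τ i) + θB * g i (τ i)) < ∑ i, (w i (σB i) + θB * g i (σB i)))
    (hC : (∀ i, ok i (σC i)) ∧ ∀ τ : Equiv.Perm V, τ ≠ σC → (∀ i, ok i (τ i)) →
      ∑ i, (w i (τ i) + θC * g i (τ i)) < ∑ i, (w i (σC i) + θC * g i (σC i)))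
    (hE : (∀ i, ok i (σE i)) ∧ ∀ τ : Equiv.Perm V, τ ≠ σE → (∀ i, ok i (τ i)) →
      ∑ i, (w i (τ i) + θE * g i (τ i)) < ∑ i, (w i (σE i) + θE * g i (σE i)))
    (hZ : (∀ i, ok i (σZ i)) ∧ ∀ τ : Equiv.Perm V, τ ≠ σZ → (∀ i, ok i (τ i)) →
      ∑ i, (w i (τ i) + θZ * g i (τ i)) < ∑ i, (w i (σZ i) + θZ * g i (σZ i)))
    (hB0 : σB (b 0) ≠ b 0) (hB1 : σB (b 1) = b 1) (hB2 : σB (b 2) = b 2) (hB3 : σB (b 3) ≠ b 3) (hB4 : σB (b 4) ≠ b 4)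
    (hC0 : σC (b 0) ≠ b 0) (hC1 : σC (b 1) = b 1) (hC2 : σC (b 2) ≠ b 2) (hC3 : σC (b 3) = b 3) (hC4 : σC (b 4) ≠ b 4)
    (hE0 : σE (b 0) ≠ b 0) (hE1 : σE (b 1) ≠ b 1) (hE2 : σE (b 2) = b 2) (hE3 : σE (b 3) = b 3) (hE4 : σE (b 4) ≠ b 4)
    (hZ0 : σZ (b 0) = b 0) (hZ1 : σZ (b 1) ≠ b 1) (hZ2 : σZ (b 2) ≠ b 2) (hZ3 : σZ (b 3) ≠ b 3) (hZ4 : σZ (b 4) = b 4)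
    (hr : Relation.TransGen (fun i j => i ≠ b 4 ∧ i ≠ b 0 ∧ j ≠ b 4 ∧ i ≠ j ∧
      (σZ j = σB i ∨ σZ j = σC i ∨ σZ j = σE i)) (σZ⁻¹ (b 3)) (b 0))
    (hp : Relation.TransGen (fun i j => i ≠ b 4 ∧ j ≠ b 4 ∧ j ≠ b 0 ∧ i ≠ j ∧ (σZ j = σB i ∨ σZ j = σC i)) (b 0) (b 1))
    (hqp : ∃ k : ℕ, ((σZ⁻¹ * σB) ^ k) (b 2) = b 1 ∧ ∀ i, i ≤ k → ((σZ⁻¹ * σB) ^ i) (b 2) ≠ b 0 ∧ ((σZ⁻¹ * σB) ^ i) (b 2) ≠ b 4)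
    (hpt : ∃ k' : ℕ, 1 ≤ k' ∧ ((σZ⁻¹ * σB) ^ k') (σZ⁻¹ (b 1)) = b 0 ∧
      ∀ i, i < k' → ((σZ⁻¹ * σB) ^ i) (σZ⁻¹ (b 1)) ≠ b 0 ∧ ((σZ⁻¹ * σB) ^ i) (σZ⁻¹ (b 1)) ≠ b 4) : False := by
  obtain ⟨k', hk', hend, hW⟩ := hpt
  refine core_K1J ok w g b hb hoff hmark haux hBC hCE hEZ hB hC hE hZ hB0 hB1 hB2 hB3 hB4 hC0 hC1 hC2 hC3 hC4 hE0 hE1 hE2 hE3 hE4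
    hZ0 hZ1 hZ2 hZ3 hZ4 hr ?_ ?_ hqp
  · have hle : (fun i j => i ≠ b 4 ∧ j ≠ b 4 ∧ j ≠ b 0 ∧ i ≠ j ∧ (σZ j = σB i ∨ σZ j = σC i)) ≤
        (fun i j => i ≠ b 4 ∧ j ≠ b 4 ∧ j ≠ b 0 ∧ i ≠ j ∧ (σZ j = σB i ∨ σZ j = σC i ∨ σZ j = σE i)) :=
      fun i j h => ⟨h.1, h.2.1, h.2.2.1, h.2.2.2.1, h.2.2.2.2.elim Or.inl (fun h' => Or.inr (Or.inl h'))⟩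
    exact transGen_weaken _ _ hle hp
  · exact transGen_of_chain (σZ⁻¹ * σB) (fun i j => σZ j = σB i ∨ σZ j = σE i) (fun i => Or.inl (by simp)) (b 4) (b 0)
      (σZ⁻¹ (b 1)) (fun h' => by have := hb h'; simp at this) k' hk' hend hW

end Core

end Core
end MarkedEdge
end Summit.ValiantsHypothesis.ValiantsHypothesis.Theorems.KPlusLogSqLaw
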